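import Summits.AtomisticToContinuum.HydrodynamicLimit.Theorems.JParityClosureRateFloorStaticFloorRung0
import Summits.AtomisticToContinuum.HydrodynamicLimit.Theorems.JParityClosureRateFloorTubeChebyshevWindow
import HarnessLib

/-!
# Line `Sketch` of crux `RateFloor`, rung 0: the static opacity floor modulo the WINDOWED decorrelation plateau
# (helper file, `--supports stmt-AtomisticToContinuum-13080`)

`stub_staticOpacityFloorRung0 ⇐ PlateauWindow` (c2 lane): the same assembly as
`JParityClosureRateFloorStaticFloorRung0.staticOpacityFloorRung0_of_plateau`, but conditional only on the WINDOWED plateau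
`PlateauWindow` of 13079's line `liouville_continuity_pins_universal_contact_value` (decorrelation of decorated dimers for
displacement sets inside the contact window `{d | d(d,0) ≤ C ε_N}`, every `C ≥ 1`) — the form a two-cluster factorisation
delivers.  The near-contact shell of the tube statistics lies in the window `C = 1 + 2L(A/σ)` (`κ_N ≤ A/σ`), and the plateau is
consumed only through `RateFloorTubeChebyshevWindow.measure_tubeSum_le_mean_sub_le_window`; everything else is the budget of the
unwindowed file, reused verbatim (`core_bound` takes the one-window Chebyshev bound as a hypothesis).
-/

noncomputable section

open scoped BigOperators Topology ENNReal Classical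
open MeasureTheory Set Filter Function
open Literature.Analysis.FluidPDE Literature.MathematicalPhysics.KineticTheory

namespace Summit.AtomisticToContinuum.HydrodynamicLimit.Theorems

namespace RateFloorStaticFloor

open RateFloorLine RateFloorPairFunctionalUpper RateFloorCutoffLoss

/-- **S7b₀ ⇐ PlateauWindow: the static opacity floor of line `Sketch` at rung 0 (constant profiles), modulo the WINDOWED decorated
pair-pair decorrelation of the canonical hard-sphere measure.** [folklore] -/
theorem staticOpacityFloorRung0_of_plateauWindow
    (hPl : ∃ σ₁ : ℝ, 0 < σ₁ ∧ ∀ σ : ℝ, 0 < σ → σ < σ₁ → ∀ C : ℝ, 1 ≤ C → ∀ ζ : ℝ, 0 < ζ → ∃ N₀ : ℕ, ∀ N : ℕ, N₀ ≤ N → ∀ i j k l : Fin (N + 1), i ≠ j → i ≠ k → i ≠ l → j ≠ k → j ≠ l → k ≠ l → ∀ (h h' : T3 → ℝ), Measurable h → Measurable h' → (∀ y, |h y| ≤ 1) → (∀ y, |h' y| ≤ 1) → ∀ T T' : Set T3, MeasurableSet T → MeasurableSet T' → T ⊆ {d | Torus.euclidDist d 0 ≤ C * hsDiameter σ N} → T'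 ⊆ {d | Torus.euclidDist d 0 ≤ C * hsDiameter σ N} → |(∫ x, h (x i) * T.indicator (fun _ => (1 : ℝ)) (x j - x i) * (h' (x k) * T'.indicator (fun _ => (1 : ℝ)) (x l - x k)) ∂posGibbsMeasure (fun _ : T3 => (1 : ℝ)) (hsDiameter σ N) (N + 1)) - (∫ x, h (x i) * T.indicator (fun _ => (1 : ℝ)) (x j - x i) ∂posGibbsMeasure (fun _ : T3 => (1 : ℝ)) (hsDiameter σ N) (N + 1)) * (∫ x, h' (x k) * T'.indicator (fun _ => (1 : ℝ)) (x l - x k) ∂posGibbsMeasure (fun _ : T3 => (1 : ℝ)) (hsDiameter σ N) (N + 1))| ≤ ζ * (volume T).toReal * (volume T').toReal) :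
    ∃ g₃ : ℝ, 0 < g₃ ∧ ∀ (a θ : ℝ) (u : Literature.MathematicalPhysics.KineticTheory.V3), 0 < a → 0 < θ → ∃ σ₀ : ℝ, 0 < σ₀ ∧ ∀ σ : ℝ, 0 < σ → σ < σ₀ → ∀ Φ : (N : ℕ) → Literature.Analysis.FluidPDE.HardSphereFlow (Literature.Analysis.FluidPDE.Torus.geometry (Fin 3)) (Literature.MathematicalPhysics.KineticTheory.hsDiameter σ N) (N + 1), ∀ τ : ℝ, 0 < τ → ∀ χ : ℝ × UnitAddTorus (Fin 3) → ℝ, Continuous χ → (∀ p, 0 ≤ χ p) → ∀ Ξ : EuclideanSpace ℝ (Fin 3) × EuclideanSpace ℝ (Fin 3) × EuclideanSpace ℝ (Fin 3) → ℝ, Continuous Ξ → (∀ q, 0 ≤ Ξ q) → (∃ C : ℝ, ∀ q, Ξ q ≤ C) → ∀ η δ : ℝ, 0 < η → 0 < δ → ∃ r₀ : ℝ, 0 < r₀ ∧ ∀ r : ℝ, 0 < r → r < r₀ → ∀ A : ℝ, 0 < A → ∀ b : ℝ, 1 / 3 ≤ b → b ≤ 1 → ∃ N₀ : ℕ, ∀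 N : ℕ, N₀ ≤ N → let ε := Literature.MathematicalPhysics.KineticTheory.hsDiameter σ N; let G := Literature.Analysis.FluidPDE.Torus.geometry (Fin 3); let γ := fun z (s : ℝ) => (Φ N).flow s z; let bx : UnitAddTorus (Fin 3) → UnitAddTorus (Fin 3) → ℝ := fun x y => 3 / (Real.pi * r ^ 3) * max (1 - Literature.Analysis.FluidPDE.Torus.euclidDist x y / r) 0; let Θ := fun (Ξ : EuclideanSpace ℝ (Fin 3) × EuclideanSpace ℝ (Fin 3) × EuclideanSpace ℝ (Fin 3) → ℝ) (v w : EuclideanSpace ℝ (Fin 3)) => ∫ ω : Metric.sphere (0 : EuclideanSpace ℝ (Fin 3)) 1, Ξ ((ω : EuclideanSpace ℝ (Fin 3)), v, w) * Literature.MathematicalPhysics.KineticTheory.hardSphereKernel (w, v) ω ∂Literature.MathematicalPhysics.KineticTheory.sphereMeasure; let B := fun Ξ z s (x₀ : UnitAddTorus (Fin 3)) => ∫ p, bx p.1.1 x₀ * bx p.2.1 x₀ * Θ Ξ p.1.2 p.2.2 ∂((Literature.Analysis.FluidPDE.empiricalMeasure (γ z s)).prod (Literature.Analysis.FluidPDE.empiricalMeasure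 (γ z s))); let SW := fun (z : Literature.Analysis.FluidPDE.Config (N + 1) (Fin 3) Literature.MathematicalPhysics.KineticTheory.T3) => lineSW ε (windowLenB A b N) τ (γ z) (fun u x y v w => χ (u, x) * Ξ (ε⁻¹ • G.sepVec x y, v, w)); Literature.MathematicalPhysics.KineticTheory.localGibbsLaw σ (fun _ => a) (fun _ => u) (fun _ => θ) N (Φ N) {z | SW z < g₃ * σ ^ 3 * (∫ s in Set.Icc (0 : ℝ) τ, ∫ x : UnitAddTorus (Fin 3), χ (s, x) * B Ξ z s x) - η} ≤ ENNReal.ofReal δ := by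
  obtain ⟨σ₁, hσ₁, hPl⟩ := hPl
  refine ⟨1 / 8, by norm_num, ?_⟩
  intro a θ u ha hθ
  -- small density, `16 λ ≤ 1/2`, and the plateau range
  obtain ⟨σ₂, hσ₂, hsmallD⟩ := exists_smallDensity uniformProfile one_pos
  have hcont : Filter.Tendsto (fun σ : ℝ => ovDensity uniformProfile σ) (nhds 0) (nhds 0) := by
    have hc : Continuous fun σ : ℝ => ovDensity uniformProfile σ := by unfold ovDensity; fun_prop
    simpa [ovDensity] using hc.tendsto 0
  have hev : ∀ᶠ σ in nhds (0 : ℝ), ovDensity uniformProfile σ < 1 / 32 :=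
    hcont (Iio_mem_nhds (by norm_num : (0 : ℝ) < 1 / 32))
  obtain ⟨σ₃, hσ₃, hσ₃prop⟩ : ∃ σ₃ > 0, ∀ σ : ℝ, |σ| < σ₃ → ovDensity uniformProfile σ < 1 / 32 := by
    rcases Metric.eventually_nhds_iff.1 hev with ⟨δ, hδ, hδprop⟩
    exact ⟨δ, hδ, fun σ hσ => hδprop (by simpa [Real.dist_eq] using hσ)⟩
  refine ⟨min σ₁ (min σ₂ σ₃), lt_min hσ₁ (lt_min hσ₂ hσ₃), ?_⟩
  intro σ hσ hσlt Φ τ hτ χ hχc hχ0 Ξ hΞc hΞ0 hΞbdd η δ hη hδ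
  have hσ₁' : σ < σ₁ := hσlt.trans_le (min_le_left _ _)
  have hσ₂' : σ < σ₂ := hσlt.trans_le ((min_le_right _ _).trans (min_le_left _ _))
  have hσ₃' : |σ| < σ₃ := by rw [abs_of_pos hσ]; exact hσlt.trans_le ((min_le_right _ _).trans (min_le_right _ _))
  have hsd : SmallDensity uniformProfile σ := (hsmallD σ hσ hσ₂').1
  have hlam : ovDensity uniformProfile σ ≤ 1 / 32 := (hσ₃prop σ hσ₃').le
  have hσ3 : 0 < σ ^ 3 := pow_pos hσ 3
  -- a positive bound of the mark
  obtain ⟨C₀, hΞC₀⟩ := hΞbdd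
  obtain ⟨C, hCdef⟩ : ∃ C : ℝ, C = max C₀ 1 := ⟨_, rfl⟩
  have hC : 0 < C := by rw [hCdef]; exact lt_of_lt_of_le one_pos (le_max_right _ _)
  have hΞC : ∀ q, Ξ q ≤ C := fun q => (hΞC₀ q).trans (by rw [hCdef]; exact le_max_left _ _)
  refine ⟨1 / 2, by norm_num, ?_⟩
  intro r hr hr2 A hA b hb1 hb2
  -- a positive bound of the weight on `[0, τ]`
  obtain ⟨Cχ₀, hCχ₀0, hχCχ₀⟩ := exists_bound_on_slab' χ hχc τ
  obtain ⟨Cχ, hCχdef⟩ : ∃ Cχ : ℝ, Cχ = Cχ₀ + 1 := ⟨_, rfl⟩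
  have hCχ : 0 < Cχ := by rw [hCχdef]; linarith
  have hχC : ∀ s ∈ Icc (0 : ℝ) τ, ∀ x : T3, χ (s, x) ≤ Cχ := fun s hs x => (hχCχ₀ s hs x).trans (by rw [hCχdef]; linarith)
  -- the ideal pair rate and the cutoff loss
  haveI := isFiniteMeasure_sphereMeasure (E := V3)
  have hS0 : 0 ≤ (sphereMeasure : Measure (Metric.sphere (0 : V3) 1)).real univ := measureReal_nonneg
  have hCSE : 0 ≤ C * (sphereMeasure : Measure (Metric.sphere (0 : V3) 1)).real univ * (‖u‖ ^ 2 + 3 * θ) := by positivity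
  obtain ⟨Θ, hΘdef⟩ : ∃ Θ : ℝ, Θ = ∫ p, sphereMark Ξ p.1 p.2 ∂((gaussMeasure u θ).prod (gaussMeasure u θ)) := ⟨_, rfl⟩
  have hΘ0 : 0 ≤ Θ := by rw [hΘdef]; exact integral_nonneg fun p => sphereMark_nonneg' hΞ0 _ _
  obtain ⟨ℓ, hℓdef⟩ : ∃ ℓ : ℝ, ℓ = η / (2 * σ ^ 3 * (τ * Cχ + 1)) := ⟨_, rfl⟩
  have hℓ0 : 0 < ℓ := by rw [hℓdef]; positivity
  obtain ⟨L, hLdef⟩ : ∃ L : ℝ, L = 8 * (C * (sphereMeasure : Measure (Metric.sphere (0 : V3) 1)).real univ * (‖u‖ ^ 2 + 3 * θ)) / ℓ + 1 :=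
    ⟨_, rfl⟩
  obtain ⟨V, hVdef⟩ : ∃ V : ℝ, V = 5 * (C * (sphereMeasure : Measure (Metric.sphere (0 : V3) 1)).real univ * (‖u‖ ^ 2 + 3 * θ)) / ℓ + 1 :=
    ⟨_, rfl⟩
  have hL : 0 < L := by rw [hLdef]; positivity
  have hV : 0 < V := by rw [hVdef]; positivity
  obtain ⟨ΘL, hΘLdef⟩ : ∃ ΘL : ℝ, ΘL = ∫ p : V3 × V3, sphereMark
      (fun q : V3 × V3 × V3 => Ξ q * speedCutoff L ‖q.2.2 - q.2.1‖ * speedCutoff V ‖q.2.1‖) p.1 p.2 *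
      (localMaxwellian 1 θ u p.1 * localMaxwellian 1 θ u p.2) := ⟨_, rfl⟩
  have hloss : Θ ≤ ΘL + ℓ := by
    have h := integral_sphereMark_le_trunc₂_add u hθ hΞc hΞ0 hΞC hL hV
    rw [integral_prod_gaussMeasure hθ u (fun p : V3 × V3 => sphereMark
      (fun q : V3 × V3 × V3 => Ξ q * speedCutoff L ‖q.2.2 - q.2.1‖ * speedCutoff V ‖q.2.1‖) p.1 p.2), ← hΘdef, ← hΘLdef] at h
    have hcut := cutoff_choice_le hCSE hℓ0
    rw [← hLdef, ← hVdef] at hcut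
    linarith
  have hℓη : σ ^ 3 * ℓ * (τ * Cχ) / 4 ≤ η / 8 := by
    rw [hℓdef]; exact loss_budget_le hσ3 hη.le (by positivity)
  -- the modulus of continuity of `χ`
  obtain ⟨ω, hωdef⟩ : ∃ ω : ℝ, ω = η / (8 * σ ^ 3 * τ * (Θ + 1)) := ⟨_, rfl⟩
  have hω : 0 < ω := by rw [hωdef]; positivity
  have hωη : σ ^ 3 * Θ * τ * ω / 2 ≤ η / 16 := by rw [hωdef]; exact omega_budget_le hσ3 hτ hΘ0 hη.le
  obtain ⟨ϑ, hϑ, -, hmod⟩ := exists_modulus_flight hχc τ (2 * V) hω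
  -- the deviation scale and the bad fraction
  obtain ⟨ρ, hρdef⟩ : ∃ ρ : ℝ, ρ = η / (8 * σ ^ 3 * τ) := ⟨_, rfl⟩
  have hρ : 0 < ρ := by rw [hρdef]; positivity
  have hρη : ρ * σ ^ 3 * τ ≤ η / 8 := by rw [hρdef]; field_simp; exact le_rfl
  obtain ⟨f, hfdef⟩ : ∃ f : ℝ, f = η / (8 * τ * σ ^ 3 * Cχ * (Θ + 1)) := ⟨_, rfl⟩
  have hf : 0 < f := by rw [hfdef]; positivity
  have hfη : f * τ * σ ^ 3 * Cχ * (Θ + 1) ≤ η / 8 := by rw [hfdef]; field_simp; exact le_rfl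
  -- the B-side threshold
  obtain ⟨N₁, hN₁⟩ := pairFunctional_upper_inProb_rung0 (u := u) hsd ha hθ Φ hτ hχc hχ0 hΞc hΞ0 hΞC hr hr2
    (η := η / σ ^ 3) (δ := δ / 2) (by positivity) (by positivity)
  -- the plateau level and its threshold
  obtain ⟨Xc, hXcdef⟩ : ∃ Xc : ℝ, Xc = 8 * Real.pi * L * (1 + 2 * L * (A / σ)) ^ 2 * C ^ 2 * (64 * (3 + 4 * L * (A / σ)) ^ 3 + 32) / ρ ^ 2 :=
    ⟨_, rfl⟩
  obtain ⟨Yc, hYcdef⟩ : ∃ Yc : ℝ, Yc = 192 * C ^ 2 * (8 * Real.pi * L * (1 + 2 * L * (A / σ)) ^ 2) ^ 2 / ρ ^ 2 := ⟨_, rfl⟩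
  obtain ⟨Zc, hZcdef⟩ : ∃ Zc : ℝ, Zc = 8 * C ^ 2 * (8 * Real.pi * L * (1 + 2 * L * (A / σ)) ^ 2) ^ 2 / ρ ^ 2 := ⟨_, rfl⟩
  have hXc0 : 0 ≤ Xc := by rw [hXcdef]; positivity
  have hYc0 : 0 ≤ Yc := by rw [hYcdef]; positivity
  have hZc0 : 0 ≤ Zc := by rw [hZcdef]; positivity
  have hδf : 0 ≤ δ * f := by positivity
  obtain ⟨ζ, hζdef⟩ : ∃ ζ : ℝ, ζ = δ * f / (16 * Cχ ^ 2 * Zc + 1) := ⟨_, rfl⟩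
  have hζ : 0 < ζ := by rw [hζdef]; positivity
  have hζsmall : Cχ ^ 2 * (ζ * Zc * 4) ≤ δ * f / 4 := by rw [hζdef]; exact zeta_budget_le hZc0 hδf
  have hCw : (1 : ℝ) ≤ 1 + 2 * L * (A / σ) := by
    have : 0 ≤ 2 * L * (A / σ) := by positivity
    linarith
  obtain ⟨N₂, hN₂⟩ := hPl σ hσ hσ₁' (1 + 2 * L * (A / σ)) hCw ζ hζ
  -- the threshold in `N`
  obtain ⟨c₁, hc₁def⟩ : ∃ c₁ : ℝ, c₁ = δ * f / (8 * (Cχ ^ 2 * (Xc * (4 / (A * σ ^ 2))) + 1)) := ⟨_, rfl⟩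
  obtain ⟨c₂, hc₂def⟩ : ∃ c₂ : ℝ, c₂ = δ * f / (8 * (Cχ ^ 2 * Yc + 1)) := ⟨_, rfl⟩
  obtain ⟨c₃, hc₃def⟩ : ∃ c₃ : ℝ, c₃ = η / (4 * (σ ^ 3 * (Θ + 1) * Cχ) + 1) := ⟨_, rfl⟩
  have hx₁ : 0 ≤ Cχ ^ 2 * (Xc * (4 / (A * σ ^ 2))) := by positivity
  have hx₂ : 0 ≤ Cχ ^ 2 * Yc := by positivity
  have hx₃ : 0 ≤ σ ^ 3 * (Θ + 1) * Cχ := by positivity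
  have hc₁ : 0 < c₁ := by rw [hc₁def]; positivity
  have hc₂ : 0 < c₂ := by rw [hc₂def]; positivity
  have hc₃ : 0 < c₃ := by rw [hc₃def]; positivity
  have hev : ∀ᶠ N : ℕ in atTop, (N₁ ≤ N ∧ N₂ ≤ N ∧ 1 ≤ N) ∧
      (windowLenB A b N ≤ ϑ ∧ windowLenB A b N ≤ τ / 2 ∧ windowLenB A b N ≤ 1 / (32 * (L + 1)) ∧ windowLenB A b N ≤ c₃) ∧
      (hsDiameter σ N ≤ 1 / 8 ∧ ((N + 1 : ℕ) : ℝ) ^ (-(1 / 3 : ℝ)) ≤ c₁ ∧ ((N + 1 : ℕ) : ℝ) / (N : ℝ) ^ 2 ≤ c₂) := by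
    filter_upwards [eventually_ge_atTop N₁, eventually_ge_atTop N₂, eventually_ge_atTop 1,
      eventually_windowLenB_le hA.le hb1 hϑ, eventually_windowLenB_le hA.le hb1 (by positivity : 0 < τ / 2),
      eventually_windowLenB_le hA.le hb1 (by positivity : 0 < 1 / (32 * (L + 1))), eventually_windowLenB_le hA.le hb1 hc₃,
      eventually_hsDiameter_le σ (by norm_num : (0 : ℝ) < 1 / 8), eventually_rpow_le hc₁, eventually_succ_div_sq_le hc₂]
      with N h1 h2 h3 h4 h5 h6 h7 h8 h9 h10
    exact ⟨⟨h1, h2, h3⟩, ⟨h4, h5, h6, h7⟩, ⟨h8, h9, h10⟩⟩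
  obtain ⟨N₀, hN₀⟩ := eventually_atTop.1 hev
  refine ⟨N₀, fun N hN => ?_⟩
  obtain ⟨⟨hNN₁, hNN₂, hN1⟩, ⟨hΔϑ, hΔτ, hΔL, hΔc₃⟩, ⟨hε8, hn13, hnN2⟩⟩ := hN₀ N hN
  /- ═════════ the fixed-`N` data ═════════ -/
  have hε := hsDiameter_pos hσ N
  have hΔ : 0 < windowLenB A b N := windowLenB_pos hA b N
  obtain ⟨κ, hκdef⟩ : ∃ κ : ℝ, κ = windowLenB A b N / hsDiameter σ N := ⟨_, rfl⟩
  have hκε : κ * hsDiameter σ N = windowLenB A b N := by rw [hκdef]; exact div_mul_cancel₀ _ hε.ne'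
  have hκ : 0 < κ := by rw [hκdef]; exact div_pos hΔ hε
  have hκ₀ : κ ≤ A / σ := by rw [hκdef]; exact kappa_le hA.le hb1 hσ N
  have hn0 : (0 : ℝ) < ((N + 1 : ℕ) : ℝ) := by positivity
  -- the chart conditions
  have hsmall2 : hsDiameter σ N * (1 + 2 * L * κ) < 1 / 2 := by
    have e : hsDiameter σ N * (1 + 2 * L * κ) = hsDiameter σ N + 2 * L * windowLenB A b N := by rw [← hκε]; ring
    rw [e]; exact chart_budget_lt hε8 hL hΔL (by norm_num) (by norm_num)
  have hsmall4 : hsDiameter σ N * (1 + 4 * κ * L) < 1 / 2 := by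
    have e : hsDiameter σ N * (1 + 4 * κ * L) = hsDiameter σ N + 4 * L * windowLenB A b N := by rw [← hκε]; ring
    rw [e]; exact chart_budget_lt hε8 hL hΔL (by norm_num) le_rfl
  have hΔη : σ ^ 3 * (Θ + 1) * windowLenB A b N * Cχ / 4 ≤ η / 16 := by
    have h1 : σ ^ 3 * (Θ + 1) * windowLenB A b N * Cχ ≤ σ ^ 3 * (Θ + 1) * Cχ * c₃ := by
      calc σ ^ 3 * (Θ + 1) * windowLenB A b N * Cχ = σ ^ 3 * (Θ + 1) * Cχ * windowLenB A b N := by ring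
        _ ≤ σ ^ 3 * (Θ + 1) * Cχ * c₃ := mul_le_mul_of_nonneg_left hΔc₃ hx₃
    have h2 : σ ^ 3 * (Θ + 1) * Cχ * c₃ ≤ η / 4 := by rw [hc₃def]; exact mul_div_budget_le' hx₃ hη.le
    linarith
  -- the per-window Chebyshev ratio
  have hq : Cχ ^ 2 * (64 * C ^ 2 * (3 + 4 * L * κ) ^ 3 * ((N + 1 : ℕ) : ℝ) ^ 2 *
          (4 / 3 * Real.pi * ((hsDiameter σ N * (1 + 2 * L * κ)) ^ 3 - hsDiameter σ N ^ 3)) +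
        2 * (((N + 1 : ℕ) : ℝ) ^ 2 * (16 * C ^ 2 * (4 / 3 * Real.pi * ((hsDiameter σ N * (1 + 2 * L * κ)) ^ 3 - hsDiameter σ N ^ 3)) +
          96 * ((N + 1 : ℕ) : ℝ) * C ^ 2 * (4 / 3 * Real.pi * ((hsDiameter σ N * (1 + 2 * L * κ)) ^ 3 - hsDiameter σ N ^ 3)) ^ 2 +
          4 * ζ * ((N + 1 : ℕ) : ℝ) ^ 2 * C ^ 2 *
            (4 / 3 * Real.pi * ((hsDiameter σ N * (1 + 2 * L * κ)) ^ 3 - hsDiameter σ N ^ 3)) ^ 2))) /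
        (ρ * ((N + 1 : ℕ) : ℝ) * N * hsDiameter σ N ^ 3 * κ) ^ 2 ≤ δ * f / 2 := by
    have hvr := varianceRatio_le (C := C) (ζ := ζ) hL.le hκ hκ₀ hε hρ hζ.le hN1
    rw [← hXcdef, ← hYcdef, ← hZcdef] at hvr
    rw [mul_div_assoc]
    -- `1/(N² ε³ κ) ≤ (4/(Aσ²)) n^{-1/3}`
    have hsq := sq_mul_eps_cube_mul_kappa_ge hA.le hb2 hσ hN1
    rw [← hκdef] at hsq
    have hpos : 0 < (N : ℝ) ^ 2 * hsDiameter σ N ^ 3 * κ := by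
      have hN0 : (0 : ℝ) < N := by exact_mod_cast hN1
      positivity
    have h13 : 0 < ((N + 1 : ℕ) : ℝ) ^ ((1 / 3 : ℝ)) := Real.rpow_pos_of_pos hn0 _
    have hrpow : ((N + 1 : ℕ) : ℝ) ^ (-(1 / 3 : ℝ)) = 1 / ((N + 1 : ℕ) : ℝ) ^ ((1 / 3 : ℝ)) := by
      rw [Real.rpow_neg hn0.le, inv_eq_one_div]
    have hAσ : 0 < A * σ ^ 2 := by positivity
    have hterm1 : Xc / ((N : ℝ) ^ 2 * hsDiameter σ N ^ 3 * κ) ≤ Xc * (4 / (A * σ ^ 2)) * ((N + 1 : ℕ) : ℝ) ^ (-(1 / 3 : ℝ)) := by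
      rw [hrpow, div_le_iff₀ hpos]
      calc Xc = Xc * (4 / (A * σ ^ 2)) * (1 / ((N + 1 : ℕ) : ℝ) ^ ((1 / 3 : ℝ))) *
            (A * σ ^ 2 / 4 * ((N + 1 : ℕ) : ℝ) ^ ((1 / 3 : ℝ))) := by field_simp
        _ ≤ Xc * (4 / (A * σ ^ 2)) * (1 / ((N + 1 : ℕ) : ℝ) ^ ((1 / 3 : ℝ))) * ((N : ℝ) ^ 2 * hsDiameter σ N ^ 3 * κ) :=
            mul_le_mul_of_nonneg_left hsq (by positivity)
    have hterm3 : ζ * Zc * (((N + 1 : ℕ) : ℝ) ^ 2 / (N : ℝ) ^ 2) ≤ ζ * Zc * 4 :=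
      mul_le_mul_of_nonneg_left (succ_sq_div_sq_le_four hN1) (mul_nonneg hζ.le hZc0)
    have hA1 : Cχ ^ 2 * (Xc * (4 / (A * σ ^ 2)) * ((N + 1 : ℕ) : ℝ) ^ (-(1 / 3 : ℝ))) ≤ δ * f / 8 := by
      calc Cχ ^ 2 * (Xc * (4 / (A * σ ^ 2)) * ((N + 1 : ℕ) : ℝ) ^ (-(1 / 3 : ℝ)))
          = Cχ ^ 2 * (Xc * (4 / (A * σ ^ 2))) * ((N + 1 : ℕ) : ℝ) ^ (-(1 / 3 : ℝ)) := by ring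
        _ ≤ Cχ ^ 2 * (Xc * (4 / (A * σ ^ 2))) * c₁ := mul_le_mul_of_nonneg_left hn13 hx₁
        _ ≤ δ * f / 8 := by rw [hc₁def]; exact mul_div_budget_le hx₁ hδf
    have hA2 : Cχ ^ 2 * (Yc * (((N + 1 : ℕ) : ℝ) / (N : ℝ) ^ 2)) ≤ δ * f / 8 := by
      calc Cχ ^ 2 * (Yc * (((N + 1 : ℕ) : ℝ) / (N : ℝ) ^ 2)) = Cχ ^ 2 * Yc * (((N + 1 : ℕ) : ℝ) / (N : ℝ) ^ 2) := by ring
        _ ≤ Cχ ^ 2 * Yc * c₂ := mul_le_mul_of_nonneg_left hnN2 hx₂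
        _ ≤ δ * f / 8 := by rw [hc₂def]; exact mul_div_budget_le hx₂ hδf
    have hCχ2 : 0 ≤ Cχ ^ 2 := sq_nonneg _
    calc Cχ ^ 2 * _ ≤ Cχ ^ 2 * (Xc / ((N : ℝ) ^ 2 * hsDiameter σ N ^ 3 * κ) + Yc * (((N + 1 : ℕ) : ℝ) / (N : ℝ) ^ 2) +
          ζ * Zc * (((N + 1 : ℕ) : ℝ) ^ 2 / (N : ℝ) ^ 2)) := mul_le_mul_of_nonneg_left hvr hCχ2
      _ ≤ Cχ ^ 2 * (Xc * (4 / (A * σ ^ 2)) * ((N + 1 : ℕ) : ℝ) ^ (-(1 / 3 : ℝ)) + Yc * (((N + 1 : ℕ) : ℝ) / (N : ℝ) ^ 2) +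
          ζ * Zc * 4) := mul_le_mul_of_nonneg_left (add_le_add (add_le_add hterm1 le_rfl) hterm3) hCχ2
      _ = Cχ ^ 2 * (Xc * (4 / (A * σ ^ 2)) * ((N + 1 : ℕ) : ℝ) ^ (-(1 / 3 : ℝ))) +
          Cχ ^ 2 * (Yc * (((N + 1 : ℕ) : ℝ) / (N : ℝ) ^ 2)) + Cχ ^ 2 * (ζ * Zc * 4) := by ring
      _ ≤ δ * f / 8 + δ * f / 8 + δ * f / 4 := add_le_add (add_le_add hA1 hA2) hζsmall
      _ = δ * f / 2 := by ring
  /- ═════════ the one-window Chebyshev bound (the plateau enters here) ═════════ -/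
  have hΞ'c : Continuous (fun q : V3 × V3 × V3 => Ξ q * speedCutoff L ‖q.2.2 - q.2.1‖ * speedCutoff V ‖q.2.1‖) :=
    continuous_trunc₂ hΞc L V
  have hΞ'0 : ∀ q, 0 ≤ (fun q : V3 × V3 × V3 => Ξ q * speedCutoff L ‖q.2.2 - q.2.1‖ * speedCutoff V ‖q.2.1‖) q := fun q =>
    (trunc₂_nonneg_le hΞ0 L V q).1
  have hΞ'C : ∀ q, |(fun q : V3 × V3 × V3 => Ξ q * speedCutoff L ‖q.2.2 - q.2.1‖ * speedCutoff V ‖q.2.1‖) q| ≤ C := fun q =>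
    abs_trunc₂_le hΞ0 hΞC L V q
  have hΞ'L : ∀ m v v' : V3, 2 * L ≤ ‖v - v'‖ →
      (fun q : V3 × V3 × V3 => Ξ q * speedCutoff L ‖q.2.2 - q.2.1‖ * speedCutoff V ‖q.2.1‖) (m, v, v') = 0 := fun m v v' h =>
    trunc₂_eq_zero_of_speed hL V m v v' h
  have ht0 : 0 < ρ * ((N + 1 : ℕ) : ℝ) * N * hsDiameter σ N ^ 3 * κ := by
    have hN0 : (0 : ℝ) < N := by exact_mod_cast hN1
    positivity
  -- the near-contact shell lies in the contact window `C = 1 + 2L(A/σ)` of the windowed plateau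
  have hshell : {d : T3 | hsDiameter σ N < ‖Torus.reprSym d‖ ∧ ‖Torus.reprSym d‖ ≤ hsDiameter σ N * (1 + 2 * L * κ)} ⊆
      {d : T3 | Torus.euclidDist d 0 ≤ (1 + 2 * L * (A / σ)) * hsDiameter σ N} := by
    intro d hd
    rw [Set.mem_setOf_eq] at hd
    rw [Set.mem_setOf_eq, Torus.euclidDist_eq, sub_zero]
    have h2 : 2 * L * κ ≤ 2 * L * (A / σ) := mul_le_mul_of_nonneg_left hκ₀ (by positivity)
    calc ‖Torus.reprSym d‖ ≤ hsDiameter σ N * (1 + 2 * L * κ) := hd.2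
      _ ≤ hsDiameter σ N * (1 + 2 * L * (A / σ)) := mul_le_mul_of_nonneg_left (by linarith) hε.le
      _ = (1 + 2 * L * (A / σ)) * hsDiameter σ N := mul_comm _ _
  have hcheb : ∀ χw : T3 → ℝ, Continuous χw → (∀ y, 0 ≤ χw y) → (∀ y, χw y ≤ Cχ) →
      localGibbsLaw σ (fun _ => a) (fun _ => u) (fun _ => θ) N (Φ N)
        {z | (∑ i : Fin (N + 1), ∑ j : Fin (N + 1), (if i ≠ j then χw (z i).1 *
            pairTubeMark (hsDiameter σ N) κ (fun q : V3 × V3 × V3 => Ξ q * speedCutoff L ‖q.2.2 - q.2.1‖ * speedCutoff V ‖q.2.1‖)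
              i j (fun m => (z m).1) (fun m => (z m).2) else 0)) ≤
          ((N + 1 : ℕ) : ℝ) * N * ((∫ y, χw y) * ((1 - 16 * ovDensity uniformProfile σ) * hsDiameter σ N ^ 3 * κ * ΘL)) -
            ρ * ((N + 1 : ℕ) : ℝ) * N * hsDiameter σ N ^ 3 * κ} ≤
        ENNReal.ofReal (δ * f / 2) := fun χw hcw h0w hCw' => by
    have h := RateFloorTubeChebyshevWindow.measure_tubeSum_le_mean_sub_le_window (u := u) (Φ N) hsd hN1 ha hθ hcw h0w hCχ hCw'
      hΞ'c hC hΞ'C hΞ'0 hL.le hκ.le hΞ'L hsmall2 hζ.le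
      (fun h hm h1 i j i' j' hij hii' hij' hji' hjj' hi'j' T T' hT hT' hTD hT'D =>
        hN₂ N hNN₂ i j i' j' hij hii' hij' hji' hjj' hi'j' h h hm hm h1 h1 T T' hT hT' (hTD.trans hshell) (hT'D.trans hshell)) ht0
    rw [← hΘLdef] at h
    exact h.trans (ENNReal.ofReal_le_ofReal hq)
  /- ═════════ the core estimate ═════════ -/
  have hcore := core_bound (r := r) hsd hθ hlam hN1 (Φ N) hτ hχc hχ0 hCχ hχC hΞc hΞ0 hΞC hL hV hη hδ
    hΘdef hΘLdef hloss hℓη hω hmod hωη hΔ hκε hΔϑ hΔτ hsmall4 hΔη hρ hρη hf hfη rfl hcheb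
    (by rw [hΘdef]; exact hN₁ N hNN₁)
  exact hcore

/-- Registered stub `stub_staticOpacityFloorRung0_of_plateauWindow` of crux stmt-AtomisticToContinuum-13080 (line `Sketch`, c2 lane):
S7b₀ (`Stubs.stub_staticOpacityFloorRung0` verbatim) from the WINDOWED plateau `PlateauWindow` (verbatim the def of 13079's line
`liouville_continuity_pins_universal_contact_value`). -/
theorem stub_staticOpacityFloorRung0_of_plateauWindow : (∃ σ₁ : ℝ, 0 < σ₁ ∧ ∀ σ : ℝ, 0 < σ → σ < σ₁ → ∀ C : ℝ, 1 ≤ C → ∀ ζ : ℝ, 0 < ζ → ∃ N₀ : ℕ, ∀ N : ℕ, N₀ ≤ N → ∀ i j k l : Fin (N + 1), i ≠ j → i ≠ k → i ≠ l → j ≠ k → j ≠ l → k ≠ l → ∀ (h h' : T3 → ℝ), Measurable h → Measurable h' → (∀ y, |h y| ≤ 1) → (∀ y, |h' y| ≤ 1) → ∀ T T' : Set T3, MeasurableSet T → MeasurableSet T' → T ⊆ {d | Torus.euclidDist d 0 ≤ C * hsDiameter σ N} → T' ⊆ {d | Torus.euclidDist d 0 ≤ C * hsDiameter σ N} → |(∫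 x, h (x i) * T.indicator (fun _ => (1 : ℝ)) (x j - x i) * (h' (x k) * T'.indicator (fun _ => (1 : ℝ)) (x l - x k)) ∂posGibbsMeasure (fun _ : T3 => (1 : ℝ)) (hsDiameter σ N) (N + 1)) - (∫ x, h (x i) * T.indicator (fun _ => (1 : ℝ)) (x j - x i) ∂posGibbsMeasure (fun _ : T3 => (1 : ℝ)) (hsDiameter σ N) (N + 1)) * (∫ x, h' (x k) * T'.indicator (fun _ => (1 : ℝ)) (x l - x k) ∂posGibbsMeasure (fun _ : T3 => (1 : ℝ)) (hsDiameter σ N) (N + 1))| ≤ ζ * (volume T).toReal * (volume T').toReal) → ∃ g₃ : ℝ, 0 < g₃ ∧ ∀ (a θ : ℝ) (u : Literature.MathematicalPhysics.KineticTheory.V3), 0 < a → 0 < θ → ∃ σ₀ : ℝ, 0 < σ₀ ∧ ∀ σ : ℝ, 0 < σ → σ < σ₀ → ∀ Φ : (N : ℕ) → Literature.Analysis.FluidPDE.HardSphereFlow (Literature.Analysis.FluidPDE.Torus.geometry (Fin 3)) (Literature.MathematicalPhysics.KineticTheory.hsDiameter σ N) (N + 1), ∀ τ : ℝ, 0 <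 τ → ∀ χ : ℝ × UnitAddTorus (Fin 3) → ℝ, Continuous χ → (∀ p, 0 ≤ χ p) → ∀ Ξ : EuclideanSpace ℝ (Fin 3) × EuclideanSpace ℝ (Fin 3) × EuclideanSpace ℝ (Fin 3) → ℝ, Continuous Ξ → (∀ q, 0 ≤ Ξ q) → (∃ C : ℝ, ∀ q, Ξ q ≤ C) → ∀ η δ : ℝ, 0 < η → 0 < δ → ∃ r₀ : ℝ, 0 < r₀ ∧ ∀ r : ℝ, 0 < r → r < r₀ → ∀ A : ℝ, 0 < A → ∀ b : ℝ, 1 / 3 ≤ b → b ≤ 1 → ∃ N₀ : ℕ, ∀ N : ℕ, N₀ ≤ N → let ε := Literature.MathematicalPhysics.KineticTheory.hsDiameter σ N; let G := Literature.Analysis.FluidPDE.Torus.geometry (Fin 3); let γ := fun z (s : ℝ) => (Φ N).flow s z; let bx : UnitAddTorus (Fin 3) → UnitAddTorus (Fin 3) → ℝ := fun x y => 3 / (Real.pi * r ^ 3) * max (1 - Literature.Analysis.FluidPDE.Torus.euclidDist x y / r) 0; let Θ := fun (Ξ : EuclideanSpace ℝ (Fin 3) × EuclideanSpace ℝ (Fin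 3) × EuclideanSpace ℝ (Fin 3) → ℝ) (v w : EuclideanSpace ℝ (Fin 3)) => ∫ ω : Metric.sphere (0 : EuclideanSpace ℝ (Fin 3)) 1, Ξ ((ω : EuclideanSpace ℝ (Fin 3)), v, w) * Literature.MathematicalPhysics.KineticTheory.hardSphereKernel (w, v) ω ∂Literature.MathematicalPhysics.KineticTheory.sphereMeasure; let B := fun Ξ z s (x₀ : UnitAddTorus (Fin 3)) => ∫ p, bx p.1.1 x₀ * bx p.2.1 x₀ * Θ Ξ p.1.2 p.2.2 ∂((Literature.Analysis.FluidPDE.empiricalMeasure (γ z s)).prod (Literature.Analysis.FluidPDE.empiricalMeasure (γ z s))); let SW := fun (z : Literature.Analysis.FluidPDE.Config (N + 1) (Fin 3) Literature.MathematicalPhysics.KineticTheory.T3) => lineSW ε (windowLenB A b N) τ (γ z) (fun u x y v w => χ (u, x) * Ξ (ε⁻¹ • G.sepVec x y, v, w)); Literature.MathematicalPhysics.KineticTheory.localGibbsLaw σ (fun _ => a) (fun _ => u) (fun _ => θ) N (Φ N) {z | SW z < g₃ * σ ^ 3 * (∫ s in Set.Icc (0 : ℝ) τ, ∫ x : UnitAddTorus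 (Fin 3), χ (s, x) * B Ξ z s x) - η} ≤ ENNReal.ofReal δ :=
  staticOpacityFloorRung0_of_plateauWindow

end RateFloorStaticFloor

end Summit.AtomisticToContinuum.HydrodynamicLimit.Theorems

end
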